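import Literature.Probability.LatticeModels.TorusGreenHessianDecay
import Literature.Probability.LatticeModels.MaxwellKernelBand
import HarnessLib

/-!
# Crux `SelfNormalisedSkewness` (stmt-QuantumFields-18944), line `Sketch`: stub `stub_twoPointKernel`

Two-sided bounds on the tree-level plaquette–plaquette kernel `π_{αα'}(n)` built from the Hessian
`H_{ij}(z) = G̃(z+eᵢ) - G̃(z+eᵢ-eⱼ) - G̃(z) + G̃(z-eⱼ)` of `G̃ = torusGreen` on `(ℤ/Sℤ)⁴`:
(UPPER) `∑_{α,α'} π_{αα'}(n)² ≤ C dist(0,n)⁻⁸` for `n ≠ 0`, from `|H_{ij}(z)| dist⁴ ≤ C₀`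
(`torusGreen_hessian_mul_dist_pow_four_le`); (LOWER) `c₀ |ñ₀|⁻⁸ ≤ ∑_{α,α'} π_{αα'}(n)²` on the cone
`|ñᵢ| ≤ δ₀|ñ₀|` (`i ≠ 0`), `16|ñ₀| ≤ S`, `|ñ₀|⁵ ≤ S⁴`: keep the diagonal entry of the plane `(1,2)`,
`π = ½(-H₁₁ - H₂₂)`; at the axis point `ñ₀e₀` the band `torusGreen_second_difference_axis_band`
gives `-H_{μμ} ≥ c ñ₀⁻⁴` (evenness of `G̃` for `ñ₀ < 0`), and the third-difference bound `hC`,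
telescoped along a lattice path of `≤ 3δ₀|ñ₀|` unit steps at distance `≥ |ñ₀|` from the origin,
moves it to `n` at the cost `≤ c/(4ñ₀⁴)`. Folklore lattice potential theory; no named facts.
-/

noncomputable section

open Finset ZMod
open scoped Real BigOperators ComplexConjugate
open Literature.Probability.LatticeModels

namespace Summit.QuantumFields.YangMills.Theorems.SelfNormalisedSkewness.Negative

/-! ### Small lemmas -/

/-- Evenness of the zero-mode-free torus Green function: `G̃(-z) = G̃(z)` (the phases are real
parts of characters and `χ_k(-z) = conj χ_k(z)`). [folklore] -/
private theorem torusGreen_neg_arg {d L : ℕ} [NeZero L] (z : TorusSite d L) :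
    torusGreen (-z) = torusGreen z := by
  -- adapted from Summits/…/LangevinControlUVFemtoCurvatureTwoPointStubFieldStrengthCovariance.lean
  unfold torusGreen
  congr 1
  refine Finset.sum_congr rfl fun k _ => ?_
  rw [← torusChar_re, ← torusChar_re, torusChar_neg_right, Complex.conj_re]

/-- Telescoping along the integers: unit steps of size `≤ ε` give `|f t - f 0| ≤ |t| ε`. [folklore] -/
private theorem abs_sub_le_of_steps (f : ℤ → ℝ) {ε : ℝ} (h : ∀ t : ℤ, |f t - f (t - 1)| ≤ ε)
    (t : ℤ) : |f t - f 0| ≤ |(t : ℝ)| * ε := by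
  induction t with
  | zero => simp
  | succ k ih =>
    have h1 := h ((k : ℤ) + 1)
    rw [add_sub_cancel_right] at h1
    have hk : |((k : ℤ) : ℝ)| = k := by simp
    have hk1 : |(((k : ℤ) + 1 : ℤ) : ℝ)| = k + 1 := by push_cast; exact abs_of_nonneg (by positivity)
    rw [hk] at ih
    rw [hk1, show f ((k : ℤ) + 1) - f 0 = (f ((k : ℤ) + 1) - f k) + (f k - f 0) by ring]
    linarith [abs_add_le (f ((k : ℤ) + 1) - f k) (f k - f 0)]
  | pred k ih =>
    have h1 := h (-(k : ℤ))
    have hk : |((-(k : ℤ) : ℤ) : ℝ)| = k := by simp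
    have hk1 : |((-(k : ℤ) - 1 : ℤ) : ℝ)| = k + 1 := by
      push_cast
      rw [show -(k : ℝ) - 1 = -(k + 1) by ring, abs_neg]
      exact abs_of_nonneg (by positivity)
    rw [hk] at ih
    rw [hk1, show f (-(k : ℤ) - 1) - f 0 = (f (-(k : ℤ)) - f 0) - (f (-(k : ℤ)) - f (-(k : ℤ) - 1)) by ring]
    linarith [abs_sub (f (-(k : ℤ)) - f 0) (f (-(k : ℤ)) - f (-(k : ℤ) - 1))]

/-- A centred coordinate is at most the Euclidean torus distance. [folklore] -/
private theorem abs_coord_le_dist {S : ℕ} (z : TorusSite 4 S) (μ₀ : Fin 4) :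
    |(((z μ₀).valMinAbs : ℤ) : ℝ)| ≤ Real.sqrt (∑ μ, (((z μ).valMinAbs : ℤ) : ℝ) ^ 2) := by
  rw [← Real.sqrt_sq_eq_abs]
  exact Real.sqrt_le_sqrt (Finset.single_le_sum (f := fun μ => (((z μ).valMinAbs : ℤ) : ℝ) ^ 2)
    (fun μ _ => sq_nonneg _) (Finset.mem_univ μ₀))

/-- A nonzero torus point is at distance `≥ 1` from the origin. [folklore] -/
private theorem one_le_dist {S : ℕ} {z : TorusSite 4 S} (hz : z ≠ 0) :
    1 ≤ Real.sqrt (∑ μ, (((z μ).valMinAbs : ℤ) : ℝ) ^ 2) := by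
  obtain ⟨μ₁, hμ₁⟩ : ∃ μ, z μ ≠ 0 := by
    by_contra h
    push Not at h
    exact hz (funext h)
  have h1 : (z μ₁).valMinAbs ≠ 0 := fun h => hμ₁ ((ZMod.valMinAbs_eq_zero _).1 h)
  have h2 : (1 : ℝ) ≤ |(((z μ₁).valMinAbs : ℤ) : ℝ)| := by
    rw [← Int.cast_abs]
    exact_mod_cast Int.one_le_abs h1
  exact h2.trans (abs_coord_le_dist z μ₁)

/-- The Hessian decay in inverse form: `|H_{ij}(z)| ≤ C₀ dist(0,z)⁻⁴` for `z ≠ 0`, `C₀ ≥ 0`. [folklore] -/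
private theorem abs_hessian_le : ∃ C₀ : ℝ, 0 ≤ C₀ ∧ ∀ (S : ℕ) [NeZero S] (i j : Fin 4)
    (z : TorusSite 4 S), z ≠ 0 →
      |torusGreen (z + Pi.single i 1) - torusGreen (z + Pi.single i 1 - Pi.single j 1) -
          torusGreen z + torusGreen (z - Pi.single j 1)| ≤
        C₀ * (Real.sqrt (∑ μ, (((z μ).valMinAbs : ℤ) : ℝ) ^ 2))⁻¹ ^ 4 := by
  obtain ⟨C, hC⟩ := torusGreen_hessian_mul_dist_pow_four_le
  refine ⟨max C 0, le_max_right _ _, fun S _ i j z hz => ?_⟩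
  have hd := one_le_dist hz
  rw [inv_pow, ← div_eq_mul_inv, le_div_iff₀ (by positivity)]
  exact (hC S i j z hz).trans (le_max_left _ _)

/-- `|a + b + c - d| ≤ |a| + |b| + |c| + |d|`. [folklore] -/
private theorem abs_add_add_sub_le (a b c d : ℝ) : |a + b + c - d| ≤ |a| + |b| + |c| + |d| :=
  (abs_sub _ _).trans (add_le_add ((abs_add_le _ _).trans
    (add_le_add (abs_add_le _ _) le_rfl)) le_rfl)

/-- A Kronecker delta does not increase absolute values. [folklore] -/
private theorem abs_mul_ite_le (x : ℝ) (p : Prop) [Decidable p] :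
    |x * (if p then 1 else 0)| ≤ |x| := by
  split_ifs <;> simp

/-! ### The axis lower bound -/

/-- On the time axis, `2G̃(z₀) - G̃(z₀+e_μ) - G̃(z₀-e_μ) ≥ c |ñ₀|⁻⁴` for `z₀ = ñ₀ e₀ ≠ 0`, `μ ≠ 0`,
`8|ñ₀| ≤ S` (the band `torusGreen_second_difference_axis_band`, with evenness for `ñ₀ < 0`). [folklore] -/
private theorem axis_lower : ∃ c : ℝ, 0 < c ∧ ∀ (S : ℕ) [NeZero S] (μ : Fin 4), μ ≠ 0 →
    ∀ x : ZMod S, x ≠ 0 → 8 * |((x.valMinAbs : ℤ) : ℝ)| ≤ S →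
      c * (|((x.valMinAbs : ℤ) : ℝ)| ^ 4)⁻¹ ≤
        2 * torusGreen (Pi.single 0 x : TorusSite 4 S) -
          torusGreen ((Pi.single 0 x : TorusSite 4 S) + Pi.single μ 1) -
          torusGreen ((Pi.single 0 x : TorusSite 4 S) - Pi.single μ 1) := by
  obtain ⟨c, C, hc, h⟩ := torusGreen_second_difference_axis_band
  refine ⟨c, hc, fun S _ μ hμ x hx h8 => ?_⟩
  have hv0 : x.valMinAbs ≠ 0 := fun h0 => hx ((ZMod.valMinAbs_eq_zero x).1 h0)
  obtain ⟨N, hN⟩ : ∃ N : ℕ, N = x.valMinAbs.natAbs := ⟨_, rfl⟩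
  have hN1 : 1 ≤ N := by rw [hN]; exact Int.natAbs_pos.2 hv0
  have hNR : ((N : ℕ) : ℝ) = |((x.valMinAbs : ℤ) : ℝ)| := by rw [hN, Nat.cast_natAbs, Int.cast_abs]
  have h8N : 8 * N ≤ S := by
    have : (8 : ℝ) * N ≤ S := by rw [hNR]; exact h8
    exact_mod_cast this
  have hNpos : (0 : ℝ) < N := by exact_mod_cast hN1
  have key : ∀ y : TorusSite 4 S, (y = Pi.single 0 ((N : ℕ) : ZMod S) ∨
      y = -Pi.single 0 ((N : ℕ) : ZMod S)) →
      c ≤ (N : ℝ) ^ 4 * (2 * torusGreen y - torusGreen (y + Pi.single μ 1) -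
        torusGreen (y - Pi.single μ 1)) := by
    rintro y (rfl | rfl)
    · exact (h S μ 0 hμ N hN1 h8N).1
    · have e1 : -(Pi.single 0 ((N : ℕ) : ZMod S) : TorusSite 4 S) + Pi.single μ 1 =
          -((Pi.single 0 ((N : ℕ) : ZMod S) : TorusSite 4 S) - Pi.single μ 1) := by abel
      have e2 : -(Pi.single 0 ((N : ℕ) : ZMod S) : TorusSite 4 S) - Pi.single μ 1 =
          -((Pi.single 0 ((N : ℕ) : ZMod S) : TorusSite 4 S) + Pi.single μ 1) := by abel
      rw [e1, e2, torusGreen_neg_arg, torusGreen_neg_arg, torusGreen_neg_arg]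
      have := (h S μ 0 hμ N hN1 h8N).1
      linarith
  have hx' : (Pi.single 0 x : TorusSite 4 S) = Pi.single 0 ((N : ℕ) : ZMod S) ∨
      (Pi.single 0 x : TorusSite 4 S) = -Pi.single 0 ((N : ℕ) : ZMod S) := by
    have hxv : x = ((x.valMinAbs : ℤ) : ZMod S) := (ZMod.coe_valMinAbs x).symm
    rcases Int.natAbs_eq x.valMinAbs with h1 | h1
    · left
      rw [hxv, h1, ← hN, Int.cast_natCast]
    · right
      rw [← Pi.single_neg, hxv, h1, ← hN, Int.cast_neg, Int.cast_natCast]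
  have hk := key _ hx'
  rw [← hNR, ← div_eq_mul_inv, div_le_iff₀ (by positivity)]
  linarith [hk]

/-! ### The upper bound -/

/-- **Upper bound**: `∑_{α,α'} π_{αα'}(n)² ≤ C dist(0,n)⁻⁸` for `n ≠ 0`: each entry of `π` is half a
signed sum of at most four Hessian entries, each `≤ C₀ dist⁻⁴`. [folklore] -/
private theorem upper_bound : ∃ C : ℝ, ∀ (S : ℕ) [NeZero S],
    ∀ (H : TorusSite 4 S → Fin 4 → Fin 4 → ℝ),
      (∀ z i j, H z i j = torusGreen (z + Pi.single i 1) -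
        torusGreen (z + Pi.single i 1 - Pi.single j 1) - torusGreen z + torusGreen (z - Pi.single j 1)) →
      ∀ (πK : TorusSite 4 S → {q : Fin 4 × Fin 4 // q.1 < q.2} → {q : Fin 4 × Fin 4 // q.1 < q.2} → ℝ),
      (∀ n α α', πK n α α' = (1 / 2 : ℝ) * (-(H n α.1.1 α'.1.1) * (if α.1.2 = α'.1.2 then 1 else 0)
          + H n α.1.1 α'.1.2 * (if α.1.2 = α'.1.1 then 1 else 0)
          + H n α.1.2 α'.1.1 * (if α.1.1 = α'.1.2 then 1 else 0)
          - H n α.1.2 α'.1.2 * (if α.1.1 = α'.1.1 then 1 else 0))) →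
      ∀ (n : TorusSite 4 S), n ≠ 0 →
        ∑ α, ∑ α', (πK n α α') ^ 2 ≤
          C * (Real.sqrt (∑ μ, (((n μ).valMinAbs : ℤ) : ℝ) ^ 2))⁻¹ ^ 8 := by
  obtain ⟨C₀, hC₀, hH0⟩ := abs_hessian_le
  refine ⟨(Fintype.card {q : Fin 4 × Fin 4 // q.1 < q.2} : ℝ) ^ 2 * (4 * C₀ ^ 2), ?_⟩
  intro S _ H hH πK hπK n hn
  set D : ℝ := Real.sqrt (∑ μ, (((n μ).valMinAbs : ℤ) : ℝ) ^ 2) with hD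
  have hB : ∀ i j, |H n i j| ≤ C₀ * D⁻¹ ^ 4 := fun i j => by
    rw [hH]
    exact hH0 S i j n hn
  have hπ : ∀ α α', |πK n α α'| ≤ 2 * (C₀ * D⁻¹ ^ 4) := by
    intro α α'
    rw [hπK, abs_mul, abs_of_pos (by norm_num : (0 : ℝ) < 1 / 2)]
    have t1 : |-(H n α.1.1 α'.1.1) * (if α.1.2 = α'.1.2 then (1 : ℝ) else 0)| ≤ C₀ * D⁻¹ ^ 4 :=
      (abs_mul_ite_le _ _).trans ((abs_neg _).trans_le (hB _ _))
    have t2 : |H n α.1.1 α'.1.2 * (if α.1.2 = α'.1.1 then (1 : ℝ) else 0)| ≤ C₀ * D⁻¹ ^ 4 :=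
      (abs_mul_ite_le _ _).trans (hB _ _)
    have t3 : |H n α.1.2 α'.1.1 * (if α.1.1 = α'.1.2 then (1 : ℝ) else 0)| ≤ C₀ * D⁻¹ ^ 4 :=
      (abs_mul_ite_le _ _).trans (hB _ _)
    have t4 : |H n α.1.2 α'.1.2 * (if α.1.1 = α'.1.1 then (1 : ℝ) else 0)| ≤ C₀ * D⁻¹ ^ 4 :=
      (abs_mul_ite_le _ _).trans (hB _ _)
    refine (mul_le_mul_of_nonneg_left ((abs_add_add_sub_le _ _ _ _).trans
      (add_le_add (add_le_add (add_le_add t1 t2) t3) t4)) (by norm_num)).trans_eq ?_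
    ring
  calc ∑ α, ∑ α', (πK n α α') ^ 2
      ≤ ∑ _α : {q : Fin 4 × Fin 4 // q.1 < q.2}, ∑ _α' : {q : Fin 4 × Fin 4 // q.1 < q.2},
          (2 * (C₀ * D⁻¹ ^ 4)) ^ 2 := by
        refine Finset.sum_le_sum fun α _ => Finset.sum_le_sum fun α' _ => ?_
        rw [← sq_abs]
        exact pow_le_pow_left₀ (abs_nonneg _) (hπ α α') 2
    _ = (Fintype.card {q : Fin 4 × Fin 4 // q.1 < q.2} : ℝ) ^ 2 * (4 * C₀ ^ 2) * D⁻¹ ^ 8 := by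
        simp only [Finset.sum_const, Finset.card_univ, nsmul_eq_mul]
        ring

/-! ### The lower bound on the cone -/

/-- **Lower bound on the cone around the time axis**: keep the diagonal entry of the plane `(1,2)`,
`π_{(12)(12)}(n) = ½(-H₁₁ - H₂₂)(n)`; `-H_{μμ}` at the axis point `ñ₀e₀` is `≥ c ñ₀⁻⁴` (the band),
and the third-difference bound `hC`, telescoped along `≤ 3δ₀|ñ₀|` unit steps at distance `≥ |ñ₀|`,
moves this to `n` up to `c/(4ñ₀⁴)`. [folklore] -/
private theorem lower_bound
    (hC : ∃ C : ℝ, ∀ (L : ℕ) [NeZero L] (i j k : Fin 4) (z : TorusSite 4 L), z ≠ 0 →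
      |(torusGreen (z + Pi.single i 1) - torusGreen (z + Pi.single i 1 - Pi.single j 1) - torusGreen (z) +
          torusGreen (z - Pi.single j 1)) -
        (torusGreen ((z - Pi.single k 1 : TorusSite 4 L) + Pi.single i 1) -
          torusGreen ((z - Pi.single k 1 : TorusSite 4 L) + Pi.single i 1 - Pi.single j 1) -
          torusGreen ((z - Pi.single k 1 : TorusSite 4 L)) +
          torusGreen ((z - Pi.single k 1 : TorusSite 4 L) - Pi.single j 1))| ≤
        C * ((Real.sqrt (∑ μ, (((z μ).valMinAbs : ℤ) : ℝ) ^ 2) ^ 5)⁻¹ + ((L : ℝ) ^ 4)⁻¹)) :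
    ∃ c₀ δ₀ : ℝ, 0 < c₀ ∧ 0 < δ₀ ∧ ∀ (S : ℕ) [NeZero S],
      ∀ (H : TorusSite 4 S → Fin 4 → Fin 4 → ℝ),
      (∀ z i j, H z i j = torusGreen (z + Pi.single i 1) -
        torusGreen (z + Pi.single i 1 - Pi.single j 1) - torusGreen z + torusGreen (z - Pi.single j 1)) →
      ∀ (πK : TorusSite 4 S → {q : Fin 4 × Fin 4 // q.1 < q.2} → {q : Fin 4 × Fin 4 // q.1 < q.2} → ℝ),
      (∀ n α α', πK n α α' = (1 / 2 : ℝ) * (-(H n α.1.1 α'.1.1) * (if α.1.2 = α'.1.2 then 1 else 0)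
          + H n α.1.1 α'.1.2 * (if α.1.2 = α'.1.1 then 1 else 0)
          + H n α.1.2 α'.1.1 * (if α.1.1 = α'.1.2 then 1 else 0)
          - H n α.1.2 α'.1.2 * (if α.1.1 = α'.1.1 then 1 else 0))) →
      ∀ (n : TorusSite 4 S), n 0 ≠ 0 →
      16 * |(((n 0).valMinAbs : ℤ) : ℝ)| ≤ S → |(((n 0).valMinAbs : ℤ) : ℝ)| ^ 5 ≤ (S : ℝ) ^ 4 →
      (∀ i : Fin 4, i ≠ 0 → |(((n i).valMinAbs : ℤ) : ℝ)| ≤ δ₀ * |(((n 0).valMinAbs : ℤ) : ℝ)|) →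
      c₀ * |(((n 0).valMinAbs : ℤ) : ℝ)|⁻¹ ^ 8 ≤ ∑ α, ∑ α', (πK n α α') ^ 2 := by
  obtain ⟨c, hc, hax⟩ := axis_lower
  obtain ⟨C₁, hC₁⟩ := hC
  set C₂ : ℝ := max C₁ 1 with hC₂
  have hC₂1 : 1 ≤ C₂ := le_max_right _ _
  have hC₁₂ : C₁ ≤ C₂ := le_max_left _ _
  have hC₂0 : 0 < C₂ := by linarith
  refine ⟨9 * c ^ 2 / 16, c / (24 * C₂), by positivity, by positivity, ?_⟩
  intro S _ H hH πK hπK n hn0 h16 h5 hcone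
  set m : ℝ := |(((n 0).valMinAbs : ℤ) : ℝ)| with hm
  have hm1 : 1 ≤ m := by
    have h1 : (n 0).valMinAbs ≠ 0 := fun h => hn0 ((ZMod.valMinAbs_eq_zero _).1 h)
    rw [hm, ← Int.cast_abs]
    exact_mod_cast Int.one_le_abs h1
  have hm0 : 0 < m := by linarith
  have hε0 : 0 ≤ 2 * C₂ * (m ^ 5)⁻¹ := by positivity
  -- the lattice path `z₀ → z₁ → z₂ → n` from the axis point `z₀ = ñ₀ e₀`
  obtain ⟨z₀, hz₀⟩ : ∃ z₀ : TorusSite 4 S, z₀ = Pi.single 0 (n 0) := ⟨_, rfl⟩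
  obtain ⟨z₁, hz₁⟩ : ∃ z₁ : TorusSite 4 S,
      z₁ = z₀ + Pi.single 1 ((((n 1).valMinAbs : ℤ)) : ZMod S) := ⟨_, rfl⟩
  obtain ⟨z₂, hz₂⟩ : ∃ z₂ : TorusSite 4 S,
      z₂ = z₁ + Pi.single 2 ((((n 2).valMinAbs : ℤ)) : ZMod S) := ⟨_, rfl⟩
  have hz₃ : z₂ + Pi.single 3 ((((n 3).valMinAbs : ℤ)) : ZMod S) = n := by
    rw [hz₂, hz₁, hz₀]
    simp only [ZMod.coe_valMinAbs]
    ext i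
    fin_cases i <;> simp
  have hb0 : z₀ 0 = n 0 := by simp [hz₀]
  have hb1 : z₁ 0 = n 0 := by simp [hz₁, hz₀]
  have hb2 : z₂ 0 = n 0 := by simp [hz₂, hz₁, hz₀]
  have c1 := hcone 1 (by decide)
  have c2 := hcone 2 (by decide)
  have c3 := hcone 3 (by decide)
  -- the per-direction bound `-H_{μμ}(n) ≥ (3c/4) ñ₀⁻⁴`, `μ ≠ 0`
  have key : ∀ μ : Fin 4, μ ≠ 0 → 3 * c / 4 * (m ^ 4)⁻¹ ≤ -H n μ μ := by
    intro μ hμ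
    obtain ⟨T, hT⟩ : ∃ T : TorusSite 4 S → ℝ, T = fun z => torusGreen (z + Pi.single μ 1) -
        torusGreen (z + Pi.single μ 1 - Pi.single μ 1) - torusGreen z +
        torusGreen (z - Pi.single μ 1) := ⟨_, rfl⟩
    -- one backward unit step in direction `k` at a point `z` over `n 0`
    have hstep : ∀ (k : Fin 4) (z : TorusSite 4 S), z 0 = n 0 →
        |T z - T (z - Pi.single k 1)| ≤ 2 * C₂ * (m ^ 5)⁻¹ := by
      intro k z hz0
      have hz : z ≠ 0 := fun h => hn0 (by rw [← hz0, h]; rfl)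
      have hdm : m ≤ Real.sqrt (∑ ν, (((z ν).valMinAbs : ℤ) : ℝ) ^ 2) := by
        rw [hm, ← hz0]; exact abs_coord_le_dist z 0
      have h2 : (Real.sqrt (∑ ν, (((z ν).valMinAbs : ℤ) : ℝ) ^ 2) ^ 5)⁻¹ ≤ (m ^ 5)⁻¹ :=
        inv_anti₀ (by positivity) (pow_le_pow_left₀ hm0.le hdm 5)
      have h3 : ((S : ℝ) ^ 4)⁻¹ ≤ (m ^ 5)⁻¹ := inv_anti₀ (by positivity) h5
      have h1 := hC₁ S μ μ k z hz
      rw [hT]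
      calc _ ≤ C₁ * ((Real.sqrt (∑ ν, (((z ν).valMinAbs : ℤ) : ℝ) ^ 2) ^ 5)⁻¹ + ((S : ℝ) ^ 4)⁻¹) := h1
        _ ≤ C₂ * ((Real.sqrt (∑ ν, (((z ν).valMinAbs : ℤ) : ℝ) ^ 2) ^ 5)⁻¹ + ((S : ℝ) ^ 4)⁻¹) :=
            mul_le_mul_of_nonneg_right hC₁₂ (by positivity)
        _ ≤ C₂ * ((m ^ 5)⁻¹ + (m ^ 5)⁻¹) := mul_le_mul_of_nonneg_left (add_le_add h2 h3) hC₂0.le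
        _ = 2 * C₂ * (m ^ 5)⁻¹ := by ring
    -- `t` unit steps in a direction `k ≠ 0` from a base point over `n 0`
    have hline : ∀ (k : Fin 4), k ≠ 0 → ∀ (b : TorusSite 4 S), b 0 = n 0 → ∀ t : ℤ,
        |T (b + Pi.single k ((t : ℤ) : ZMod S)) - T b| ≤ |(t : ℝ)| * (2 * C₂ * (m ^ 5)⁻¹) := by
      intro k hk b hb t
      have hs : ∀ s : ℤ, |T (b + Pi.single k ((s : ℤ) : ZMod S)) -
          T (b + Pi.single k (((s - 1 : ℤ)) : ZMod S))| ≤ 2 * C₂ * (m ^ 5)⁻¹ := by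
        intro s
        have e : b + Pi.single k (((s - 1 : ℤ)) : ZMod S) =
            b + Pi.single k ((s : ℤ) : ZMod S) - Pi.single k 1 := by
          rw [Int.cast_sub, Int.cast_one, Pi.single_sub]
          abel
        rw [e]
        refine hstep k _ ?_
        rw [Pi.add_apply, Pi.single_eq_of_ne (Ne.symm hk), add_zero, hb]
      have h := abs_sub_le_of_steps (fun s : ℤ => T (b + Pi.single k ((s : ℤ) : ZMod S))) hs t
      simpa only [Int.cast_zero, Pi.single_zero, add_zero] using h
    have d1 := hline 1 (by decide) z₀ hb0 (n 1).valMinAbs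
    have d2 := hline 2 (by decide) z₁ hb1 (n 2).valMinAbs
    have d3 := hline 3 (by decide) z₂ hb2 (n 3).valMinAbs
    rw [← hz₁] at d1
    rw [← hz₂] at d2
    rw [hz₃] at d3
    have htot : |T n - T z₀| ≤ c / 4 * (m ^ 4)⁻¹ := by
      have e : T n - T z₀ = (T n - T z₂) + (T z₂ - T z₁) + (T z₁ - T z₀) := by ring
      calc |T n - T z₀| ≤ |T n - T z₂| + |T z₂ - T z₁| + |T z₁ - T z₀| := by
            rw [e]
            exact (abs_add_le _ _).trans (add_le_add (abs_add_le _ _) le_rfl)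
        _ ≤ (c / (24 * C₂) * m) * (2 * C₂ * (m ^ 5)⁻¹) + (c / (24 * C₂) * m) * (2 * C₂ * (m ^ 5)⁻¹) +
              (c / (24 * C₂) * m) * (2 * C₂ * (m ^ 5)⁻¹) :=
            add_le_add (add_le_add (d3.trans (mul_le_mul_of_nonneg_right c3 hε0))
              (d2.trans (mul_le_mul_of_nonneg_right c2 hε0)))
              (d1.trans (mul_le_mul_of_nonneg_right c1 hε0))
        _ = c / 4 * (m ^ 4)⁻¹ := by
            field_simp
            ring
    -- the axis point
    have haxis : c * (m ^ 4)⁻¹ ≤ -T z₀ := by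
      have h8 : 8 * m ≤ S := by linarith
      have h := hax S μ hμ (n 0) hn0 h8
      have e : -T z₀ = 2 * torusGreen z₀ - torusGreen (z₀ + Pi.single μ 1) -
          torusGreen (z₀ - Pi.single μ 1) := by
        rw [hT]
        simp only [add_sub_cancel_right]
        ring
      rw [e, hz₀]
      exact h
    have hup := (abs_le.1 htot).2
    have hTn : H n μ μ = T n := by rw [hH, hT]
    rw [hTn]
    linarith
  -- the diagonal entry of the plane `(1, 2)`
  obtain ⟨α₀, hα₀⟩ : ∃ α₀ : {q : Fin 4 × Fin 4 // q.1 < q.2}, α₀.1 = (1, 2) :=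
    ⟨⟨(1, 2), by decide⟩, rfl⟩
  have hπ : πK n α₀ α₀ = (1 / 2 : ℝ) * (-H n 1 1 - H n 2 2) := by
    rw [hπK, hα₀]
    norm_num [show (2 : Fin 4) ≠ 1 by decide, show (1 : Fin 4) ≠ 2 by decide]
  have k1 := key 1 (by decide)
  have k2 := key 2 (by decide)
  have hπge : 3 * c / 4 * (m ^ 4)⁻¹ ≤ πK n α₀ α₀ := by
    rw [hπ]
    linarith
  have hπnn : 0 ≤ 3 * c / 4 * (m ^ 4)⁻¹ := by positivity
  calc 9 * c ^ 2 / 16 * m⁻¹ ^ 8 = (3 * c / 4 * (m ^ 4)⁻¹) ^ 2 := by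
        field_simp
        ring
    _ ≤ (πK n α₀ α₀) ^ 2 := pow_le_pow_left₀ hπnn hπge 2
    _ ≤ ∑ α', (πK n α₀ α') ^ 2 :=
        Finset.single_le_sum (f := fun α' => (πK n α₀ α') ^ 2) (fun _ _ => sq_nonneg _)
          (Finset.mem_univ α₀)
    _ ≤ ∑ α, ∑ α', (πK n α α') ^ 2 :=
        Finset.single_le_sum (f := fun α => ∑ α', (πK n α α') ^ 2)
          (fun _ _ => Finset.sum_nonneg fun _ _ => sq_nonneg _) (Finset.mem_univ α₀)

/-! ### The stub -/

/-- **Stub `stub_twoPointKernel`** of line `Sketch` (crux `SelfNormalisedSkewness`, registered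
signature, verbatim): the tree-level plaquette–plaquette kernel `π_{αα'}(n)` on `(ℤ/Sℤ)⁴` satisfies
`∑_{α,α'} π_{αα'}(n)² ≤ C dist(0,n)⁻⁸` for `n ≠ 0`, and `≥ c₀ |ñ₀|⁻⁸` on the cone
`|ñᵢ| ≤ δ₀|ñ₀|` (`i ≠ 0`), `16|ñ₀| ≤ S`, `|ñ₀|⁵ ≤ S⁴`, given the third-difference bound `hC`
(`stub_torusGreenThirdDiff`). [folklore] -/
theorem stub_twoPointKernel
    (hC : ∃ C : ℝ, ∀ (L : ℕ) [NeZero L] (i j k : Fin 4) (z : TorusSite 4 L), z ≠ 0 →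
      |(torusGreen (z + Pi.single i 1) - torusGreen (z + Pi.single i 1 - Pi.single j 1) - torusGreen (z) +
          torusGreen (z - Pi.single j 1)) -
        (torusGreen ((z - Pi.single k 1 : TorusSite 4 L) + Pi.single i 1) -
          torusGreen ((z - Pi.single k 1 : TorusSite 4 L) + Pi.single i 1 - Pi.single j 1) -
          torusGreen ((z - Pi.single k 1 : TorusSite 4 L)) + torusGreen ((z - Pi.single k 1 : TorusSite 4 L) - Pi.single j 1))| ≤
        C * ((Real.sqrt (∑ μ, (((z μ).valMinAbs : ℤ) : ℝ) ^ 2) ^ 5)⁻¹ + ((L : ℝ) ^ 4)⁻¹)) :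
    (∃ C : ℝ, ∀ (S : ℕ) [NeZero S],
      ∀ (H : TorusSite 4 S → Fin 4 → Fin 4 → ℝ),
      (∀ z i j, H z i j = torusGreen (z + Pi.single i 1) - torusGreen (z + Pi.single i 1 - Pi.single j 1) -
        torusGreen z + torusGreen (z - Pi.single j 1)) →
      ∀ (πK : TorusSite 4 S → {q : Fin 4 × Fin 4 // q.1 < q.2} → {q : Fin 4 × Fin 4 // q.1 < q.2} → ℝ),
      (∀ n α α', πK n α α' = (1 / 2 : ℝ) * (-(H n α.1.1 α'.1.1) * (if α.1.2 = α'.1.2 then 1 else 0)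
          + H n α.1.1 α'.1.2 * (if α.1.2 = α'.1.1 then 1 else 0)
          + H n α.1.2 α'.1.1 * (if α.1.1 = α'.1.2 then 1 else 0)
          - H n α.1.2 α'.1.2 * (if α.1.1 = α'.1.1 then 1 else 0))) →
      ∀ (n : TorusSite 4 S), n ≠ 0 →
      ∑ α, ∑ α', (πK n α α') ^ 2 ≤ C * (Real.sqrt (∑ μ, (((n μ).valMinAbs : ℤ) : ℝ) ^ 2))⁻¹ ^ 8) ∧
    (∃ c₀ δ₀ : ℝ, 0 < c₀ ∧ 0 < δ₀ ∧ ∀ (S : ℕ) [NeZero S],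
      ∀ (H : TorusSite 4 S → Fin 4 → Fin 4 → ℝ),
      (∀ z i j, H z i j = torusGreen (z + Pi.single i 1) - torusGreen (z + Pi.single i 1 - Pi.single j 1) -
        torusGreen z + torusGreen (z - Pi.single j 1)) →
      ∀ (πK : TorusSite 4 S → {q : Fin 4 × Fin 4 // q.1 < q.2} → {q : Fin 4 × Fin 4 // q.1 < q.2} → ℝ),
      (∀ n α α', πK n α α' = (1 / 2 : ℝ) * (-(H n α.1.1 α'.1.1) * (if α.1.2 = α'.1.2 then 1 else 0)
          + H n α.1.1 α'.1.2 * (if α.1.2 = α'.1.1 then 1 else 0)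
          + H n α.1.2 α'.1.1 * (if α.1.1 = α'.1.2 then 1 else 0)
          - H n α.1.2 α'.1.2 * (if α.1.1 = α'.1.1 then 1 else 0))) →
      ∀ (n : TorusSite 4 S), n 0 ≠ 0 →
      16 * |(((n 0).valMinAbs : ℤ) : ℝ)| ≤ S → |(((n 0).valMinAbs : ℤ) : ℝ)| ^ 5 ≤ (S : ℝ) ^ 4 →
      (∀ i : Fin 4, i ≠ 0 → |(((n i).valMinAbs : ℤ) : ℝ)| ≤ δ₀ * |(((n 0).valMinAbs : ℤ) : ℝ)|) →
      c₀ * |(((n 0).valMinAbs : ℤ) : ℝ)|⁻¹ ^ 8 ≤ ∑ α, ∑ α', (πK n α α') ^ 2) := by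
  exact ⟨upper_bound, lower_bound hC⟩

end Summit.QuantumFields.YangMills.Theorems.SelfNormalisedSkewness.Negative
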